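import Mathlib.MeasureTheory.Integral.IntervalIntegral.Basic
import Mathlib.MeasureTheory.Measure.Lebesgue.Basic
import Mathlib.NumberTheory.Harmonic.Bounds
import Literature.Analysis.SpecialFunctions.EulerMascheroniBounds
import HarnessLib

/-!
# The diagonal sum of the Balasubramanian–Conrey–Heath-Brown mean square:
# `Σ_ℓ ℓ⁻¹ |{t ∈ [T, 2T] : 2πℓ²M² ≤ t}| = T(½ log(T/(2πM²)) + γ + log 2 − ½) + O(M²)`

Topic `Literature/NumberTheory/LFunctions`. Everything in this file is PROVED (no named facts; the
only definitions are transparent abbreviations for the sums that are estimated).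

## Context

The twisted mean square of Balasubramanian, Conrey and Heath-Brown (the named fact
`Literature.Barriers.RiemannHypothesis.BalasubramanianConreyHeathBrown1985_meanSquare`, quoted from
[BettinChandeeRadziwill2017, (1.2)]),
`∫_T^{2T} |ζ(½+it)|² |A(½+it)|² dt = T Σ_{h,k ≤ N} a_h ā_k/[h,k] · (log(T(h,k)²/(2πhk)) + 2γ + log 4 − 1) + o(T)`
(`N = T^θ`, `θ < ½`), is approached in the tree along the route of Titchmarsh §§7.4, 9.20–9.23 and
Levinson 1974, §§3–4: `|ζ(½+it)|² = Z(t)²`, `Z = z + z̄ + O(t^{-1/4})` with the approximate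
functional equation sum `z(t) = e^{iϑ(t)} Σ_{n ≤ √(t/2π)} n^{-1/2-it}` of `t`-dependent length, and
`2∫_T^{2T} |z A|² dt` is evaluated by the mean value theorem for "activated" Dirichlet polynomials
(`Literature.NumberTheory.LFunctions.DirichletMVT.norm_weighted_meanSquare_activated_sub_le_crude`,
activation time `2πn²` for the frequency `n`). Its diagonal consists of the coincidences
`hn = kn'`, i.e. `n = ℓk'`, `n' = ℓh'` with `h = (h,k)h'`, `k = (h,k)k'`, and equals
`Σ_{h,k} a_h ā_k/[h,k] · D(M_{hk}, T)` with `M_{hk} = max(h',k')` and the **diagonal sum**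

  `D(M, T) = Σ_{ℓ ≥ 1} ℓ⁻¹ · |{t ∈ [T, 2T] : 2πℓ²M² ≤ t}| = Σ_{ℓ ≥ 1} ℓ⁻¹ (2T − max(T, 2πℓ²M²))⁺`

(Titchmarsh §7.4 is the case `M = 1`, `A = 1`: "`Σ_{m=n} ∫ … = Σ_n n⁻¹ (T − 2πn²) + …`"). This file
proves the asymptotic evaluation of `D(M, T)` with an absolute error constant:

* `BCH.abs_diagSum_sub_diagMain_le` — in the normalised variable `A = T/(2πM²)`:
  `|Σ_{ℓ ≤ L} ℓ⁻¹(2A − max(A, ℓ²))⁺ − A(½ log A + γ + log 2 − ½)| ≤ 13` for every `A > 0` and every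
  `L` with `(L+1)² > 2A` (the terms with `ℓ² > 2A` vanish);
* `BCH.abs_bchDiagSum_sub_le` — the scaled form:
  `|D_L(M, T) − T(½ log(T/(2πM²)) + γ + log 2 − ½)| ≤ 26π M²` for `M, T > 0`, `πM²(L+1)² > T`;
* `BCH.integral_indicator_le_eq_max`, `BCH.integral_indicator_le_eq_max_complex`,
  `BCH.integral_indicator_activation_eq` — the bridge to the activated mean value theorem:
  `∫_T^{T'} [c ≤ t] dt = (T' − max(T, c))⁺`.

Consequently the diagonal of `2∫_T^{2T}|zA|²` is
`T Σ_{h,k} a_h ā_k/[h,k] (log(T/(2πM_{hk}²)) + 2γ + log 4 − 1) + O(Σ_{h,k} |a_h a_k| M_{hk}²/[h,k])`, the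
error being `O(N^{2+ε})`, i.e. the `N²T^ε` of [BalasubramanianConreyHeathBrown1985] (as quoted in
[Yu2023, §1]); the cross terms `2 Re ∫ z² |A|²` supply the complementary
`T Σ a_h ā_k/[h,k] log(M_{hk}²/(h'k'))`, and together they give the kernel `log(T(h,k)²/(2πhk)) + 2γ + log 4 − 1`.

## Proof

With `p = ⌊√A⌋`, `q = ⌊√(2A)⌋` the sum is exactly `2A·H_q − A·H_p − q(q+1)/2 + p(p+1)/2`
(`H_n = Σ_{ℓ ≤ n} 1/ℓ`). Writing `H_n = log n + γ + 1/(2n) + O(n⁻²)` (the tree's second-order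
sequences `Literature.Analysis.SpecialFunctions.Real.lowerSeq_le`, `le_upperSeq`), `A = p² + a`,
`2A = q² + b` (`0 ≤ a < 2p+1`, `0 ≤ b < 2q+1`) and `|log(1−x) + x| ≤ x²/(1−x)` (Mathlib), all terms of
size `√A` cancel identically and what is left is bounded by `9/2 + 9/2 + 3/2 + 3/2 + 1/2 + 1/2 = 13`.

## References

* [BettinChandeeRadziwill2017] S. Bettin, V. Chandee, M. Radziwiłł, J. reine angew. Math. 729 (2017),
  §1 eq. (1.2) (the main term `log(T(d,e)²/(2πde)) + 2γ + log 4 − 1`).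
* [Titchmarsh1986] E. C. Titchmarsh, *The Theory of the Riemann Zeta-Function*, 2nd ed. (1986),
  §7.4 (the diagonal `Σ_n n⁻¹(T − 2πn²)` of the mean square of the approximate functional equation).
* [BalasubramanianConreyHeathBrown1985] R. Balasubramanian, J. B. Conrey, D. R. Heath-Brown, J. reine
  angew. Math. 357 (1985), 161–181 (not held; remainder `M²T^ε + T log^{-c} T` as quoted in
  [Yu2023, §1]).
-/

noncomputable section

open Finset Real MeasureTheory Set

namespace Literature.NumberTheory.LFunctions.BCH

/-! ### The players -/

/-- The weight `g_A(ℓ) = (2A − max(A, ℓ²))⁺ / ℓ` of the normalised diagonal sum (`= ℓ⁻¹·T⁻¹`-scaled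
`|{t ∈ [T,2T] : 2πℓ²M² ≤ t}|` with `A = T/(2πM²)`). [folklore] -/
def diagWeight (A : ℝ) (ℓ : ℕ) : ℝ := max (2 * A - max A ((ℓ : ℝ) ^ 2)) 0 / ℓ

/-- The normalised diagonal sum `G_L(A) = Σ_{1 ≤ ℓ ≤ L} (2A − max(A, ℓ²))⁺ / ℓ`. [folklore] -/
def diagSum (A : ℝ) (L : ℕ) : ℝ := ∑ ℓ ∈ Finset.Icc 1 L, diagWeight A ℓ

/-- The main term `A(½ log A + γ + log 2 − ½)` of the normalised diagonal sum. [folklore] -/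
def diagMain (A : ℝ) : ℝ :=
  A * (Real.log A / 2 + Real.eulerMascheroniConstant + Real.log 2 - 1 / 2)

/-- The real harmonic number `H_n = Σ_{1 ≤ ℓ ≤ n} 1/ℓ`. [folklore] -/
def harmonicR (n : ℕ) : ℝ := ∑ ℓ ∈ Finset.Icc 1 n, 1 / (ℓ : ℝ)

/-- Unfolding `diagWeight`. [folklore] -/
theorem diagWeight_def (A : ℝ) (ℓ : ℕ) :
    diagWeight A ℓ = max (2 * A - max A ((ℓ : ℝ) ^ 2)) 0 / ℓ := rfl

/-- Unfolding `diagSum`. [folklore] -/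
theorem diagSum_def (A : ℝ) (L : ℕ) : diagSum A L = ∑ ℓ ∈ Finset.Icc 1 L, diagWeight A ℓ := rfl

/-- Unfolding `diagMain`. [folklore] -/
theorem diagMain_def (A : ℝ) :
    diagMain A = A * (Real.log A / 2 + Real.eulerMascheroniConstant + Real.log 2 - 1 / 2) := rfl

/-! ### Second-order harmonic asymptotics `H_n = log n + γ + 1/(2n) + O(n⁻²)` -/

/-- `H_n` is Mathlib's `harmonic n`. [folklore] -/
theorem harmonicR_eq_harmonic (n : ℕ) : harmonicR n = ((harmonic n : ℚ) : ℝ) := by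
  rw [harmonicR, harmonic_eq_sum_Icc]
  push_cast
  exact Finset.sum_congr rfl fun r _ => by rw [one_div]

/-- `H_n ≤ log n + γ + 1/(2n)` for `n ≥ 1` (the sequence `H_n − log n − 1/(2n)` increases to `γ`).
[folklore] -/
theorem harmonicR_le {n : ℕ} (hn : 1 ≤ n) :
    harmonicR n ≤ Real.log n + Real.eulerMascheroniConstant + 1 / (2 * n) := by
  have h := Literature.Analysis.SpecialFunctions.Real.lowerSeq_le n hn
  rw [Literature.Analysis.SpecialFunctions.Real.lowerSeq] at h
  rw [harmonicR_eq_harmonic]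
  linarith

/-- `log n + γ + 1/(2n) − 1/(8n²) ≤ H_n` for `n ≥ 1` (from `γ ≤ H_n − log(n + ½)` and
`log(1 + 1/(2n)) ≥ 2/(4n+1)`). [folklore] -/
theorem le_harmonicR {n : ℕ} (hn : 1 ≤ n) :
    Real.log n + Real.eulerMascheroniConstant + 1 / (2 * n) - 1 / (8 * (n : ℝ) ^ 2) ≤
      harmonicR n := by
  have hn0 : (0 : ℝ) < n := by exact_mod_cast hn
  have h := Literature.Analysis.SpecialFunctions.Real.le_upperSeq n
  rw [Literature.Analysis.SpecialFunctions.Real.upperSeq] at h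
  rw [harmonicR_eq_harmonic]
  -- `log(n + 1/2) = log n + log(1 + (2n)⁻¹)`
  have hsplit : Real.log ((n : ℝ) + 1 / 2) = Real.log n + Real.log (1 + (2 * (n : ℝ))⁻¹) := by
    rw [← Real.log_mul hn0.ne' (by positivity)]
    congr 1
    field_simp
  rw [hsplit] at h
  have hlow := Literature.Analysis.SpecialFunctions.Real.two_div_le_log_one_add_inv
    (show (0 : ℝ) < 2 * n by positivity)
  -- `2/(4n+1) ≥ 1/(2n) − 1/(8n²)`
  have hcmp : 1 / (2 * (n : ℝ)) - 1 / (8 * (n : ℝ) ^ 2) ≤ 2 / (2 * (2 * (n : ℝ)) + 1) := by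
    rw [div_sub_div _ _ (mul_pos two_pos hn0).ne' (mul_pos (by norm_num) (pow_pos hn0 2)).ne',
      div_le_div_iff₀ (by positivity) (by positivity)]
    nlinarith
  linarith

/-! ### Elementary sums -/

/-- `Σ_{1 ≤ ℓ ≤ n} ℓ = n(n+1)/2` in `ℝ`. [folklore] -/
theorem sum_Icc_one_cast (n : ℕ) : ∑ ℓ ∈ Finset.Icc 1 n, (ℓ : ℝ) = (n : ℝ) * (n + 1) / 2 := by
  induction n with
  | zero => simp
  | succ n ih =>
    rw [Finset.sum_Icc_succ_top (by omega), ih]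
    push_cast
    ring

/-- Splitting `Σ_{1 ≤ ℓ ≤ L}` at `p ≤ q ≤ L`. [folklore] -/
theorem sum_Icc_one_split (f : ℕ → ℝ) {p q L : ℕ} (hpq : p ≤ q) (hqL : q ≤ L) :
    ∑ ℓ ∈ Finset.Icc 1 L, f ℓ =
      ∑ ℓ ∈ Finset.Icc 1 p, f ℓ + ∑ ℓ ∈ Finset.Ioc p q, f ℓ + ∑ ℓ ∈ Finset.Ioc q L, f ℓ := by
  have e : ∀ m : ℕ, Finset.Icc 1 m = Finset.Ioc 0 m := fun m => by
    ext x; simp only [Finset.mem_Icc, Finset.mem_Ioc]; omega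
  rw [e, e, ← Finset.sum_Ioc_consecutive f (Nat.zero_le q) hqL,
    ← Finset.sum_Ioc_consecutive f (Nat.zero_le p) hpq]

/-- `Σ_{p < ℓ ≤ q} f = Σ_{ℓ ≤ q} f − Σ_{ℓ ≤ p} f`. [folklore] -/
theorem sum_Ioc_eq_sub (f : ℕ → ℝ) {p q : ℕ} (hpq : p ≤ q) :
    ∑ ℓ ∈ Finset.Ioc p q, f ℓ = ∑ ℓ ∈ Finset.Icc 1 q, f ℓ - ∑ ℓ ∈ Finset.Icc 1 p, f ℓ := by
  have e : ∀ m : ℕ, Finset.Icc 1 m = Finset.Ioc 0 m := fun m => by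
    ext x; simp only [Finset.mem_Icc, Finset.mem_Ioc]; omega
  rw [e, e, ← Finset.sum_Ioc_consecutive f (Nat.zero_le p) hpq]
  ring

/-! ### The three ranges of the weight -/

/-- `ℓ² ≤ A`: the weight is `A/ℓ`. [folklore] -/
theorem diagWeight_of_sq_le {A : ℝ} {ℓ : ℕ} (h : ((ℓ : ℝ)) ^ 2 ≤ A) : diagWeight A ℓ = A / ℓ := by
  have hA : 0 ≤ A := le_trans (sq_nonneg _) h
  rw [diagWeight, max_eq_left h, show 2 * A - A = A by ring, max_eq_left hA]

/-- `A < ℓ² ≤ 2A`: the weight is `2A/ℓ − ℓ`. [folklore] -/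
theorem diagWeight_of_lt_sq_of_sq_le {A : ℝ} {ℓ : ℕ} (h1 : A < ((ℓ : ℝ)) ^ 2)
    (h2 : ((ℓ : ℝ)) ^ 2 ≤ 2 * A) : diagWeight A ℓ = 2 * A / ℓ - ℓ := by
  rw [diagWeight, max_eq_right h1.le, max_eq_left (by linarith), sub_div, pow_two,
    mul_self_div_self]

/-- `2A < ℓ²` (and `0 ≤ A`): the weight vanishes. [folklore] -/
theorem diagWeight_of_two_mul_lt_sq {A : ℝ} {ℓ : ℕ} (hA : 0 ≤ A) (h : 2 * A < ((ℓ : ℝ)) ^ 2) :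
    diagWeight A ℓ = 0 := by
  have h1 : A ≤ ((ℓ : ℝ)) ^ 2 := by linarith
  rw [diagWeight, max_eq_right h1, max_eq_right (by linarith), zero_div]

/-- The weight is non-negative. [folklore] -/
theorem diagWeight_nonneg (A : ℝ) (ℓ : ℕ) : 0 ≤ diagWeight A ℓ :=
  div_nonneg (le_max_right _ _) (Nat.cast_nonneg _)

/-- For `0 ≤ A ≤ 1` the weight is at most `1` at `ℓ = 1` and vanishes for `ℓ ≥ 2`. [folklore] -/
theorem diagWeight_le_of_le_one {A : ℝ} (hA : 0 ≤ A) (hA1 : A ≤ 1) {ℓ : ℕ} (hℓ : 1 ≤ ℓ) :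
    diagWeight A ℓ ≤ if ℓ = 1 then 1 else 0 := by
  split_ifs with h
  · subst h
    rw [diagWeight, Nat.cast_one, div_one, one_pow, max_eq_right hA1]
    exact max_le (by linarith) zero_le_one
  · have hℓ2 : (2 : ℝ) ≤ ℓ := by exact_mod_cast (show 2 ≤ ℓ by omega)
    have : 2 * A < ((ℓ : ℝ)) ^ 2 := by nlinarith
    exact (diagWeight_of_two_mul_lt_sq hA this).le

/-! ### Integer square roots of `A` and `2A` -/

/-- For `B ≥ 0` the integer `r = Nat.sqrt ⌊B⌋` satisfies `r² ≤ B < (r+1)²`. [folklore] -/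
theorem natSqrt_floor_spec {B : ℝ} (hB : 0 ≤ B) :
    ((Nat.sqrt ⌊B⌋₊ : ℕ) : ℝ) ^ 2 ≤ B ∧ B < (((Nat.sqrt ⌊B⌋₊ : ℕ) : ℝ) + 1) ^ 2 := by
  set r := Nat.sqrt ⌊B⌋₊ with hr
  constructor
  · have h1 : r * r ≤ ⌊B⌋₊ := Nat.sqrt_le ⌊B⌋₊
    have h2 : ((r * r : ℕ) : ℝ) ≤ (⌊B⌋₊ : ℝ) := by exact_mod_cast h1
    push_cast at h2
    rw [sq]
    linarith [Nat.floor_le hB]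
  · have h1 : ⌊B⌋₊ < (r + 1) * (r + 1) := Nat.lt_succ_sqrt ⌊B⌋₊
    have h2 : ⌊B⌋₊ + 1 ≤ (r + 1) * (r + 1) := h1
    have h3 : ((⌊B⌋₊ + 1 : ℕ) : ℝ) ≤ (((r + 1) * (r + 1) : ℕ) : ℝ) := by exact_mod_cast h2
    push_cast at h3
    rw [add_sq, sq]
    nlinarith [Nat.lt_floor_add_one B]

/-! ### Exact evaluation of the sum -/

/-- **Exact evaluation.** If `p² ≤ A < (p+1)²`, `q² ≤ 2A < (q+1)²`, `1 ≤ p` and `q ≤ L`, then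
`Σ_{ℓ ≤ L} g_A(ℓ) = 2A·H_q − A·H_p − q(q+1)/2 + p(p+1)/2`. [folklore] -/
theorem diagSum_eq {A : ℝ} {p q L : ℕ} (hpA : ((p : ℝ)) ^ 2 ≤ A)
    (hAp : A < ((p : ℝ) + 1) ^ 2) (hqA : ((q : ℝ)) ^ 2 ≤ 2 * A) (hAq : 2 * A < ((q : ℝ) + 1) ^ 2)
    (hqL : q ≤ L) :
    diagSum A L = 2 * A * harmonicR q - A * harmonicR p
      - (q : ℝ) * (q + 1) / 2 + (p : ℝ) * (p + 1) / 2 := by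
  have hA0 : 0 ≤ A := le_trans (sq_nonneg _) hpA
  have hpq : p ≤ q := by
    have h1 : ((p : ℝ)) ^ 2 < ((q : ℝ) + 1) ^ 2 := lt_of_le_of_lt (le_trans hpA (by linarith)) hAq
    have h2 : (p : ℝ) < (q : ℝ) + 1 := lt_of_pow_lt_pow_left₀ 2 (by positivity) h1
    have h3 : p < q + 1 := by exact_mod_cast h2
    omega
  rw [diagSum, sum_Icc_one_split _ hpq hqL]
  -- range 1: `ℓ ≤ p`
  have e1 : ∑ ℓ ∈ Finset.Icc 1 p, diagWeight A ℓ = A * harmonicR p := by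
    rw [harmonicR, Finset.mul_sum]
    refine Finset.sum_congr rfl fun ℓ hℓ => ?_
    rw [Finset.mem_Icc] at hℓ
    have hℓp : (ℓ : ℝ) ≤ p := by exact_mod_cast hℓ.2
    have hℓ0 : (0 : ℝ) ≤ ℓ := Nat.cast_nonneg ℓ
    have hsq : ((ℓ : ℝ)) ^ 2 ≤ A := le_trans (pow_le_pow_left₀ hℓ0 hℓp 2) hpA
    rw [diagWeight_of_sq_le hsq, mul_one_div]
  -- range 2: `p < ℓ ≤ q`
  have e2 : ∑ ℓ ∈ Finset.Ioc p q, diagWeight A ℓ =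
      2 * A * (harmonicR q - harmonicR p) - ((q : ℝ) * (q + 1) / 2 - (p : ℝ) * (p + 1) / 2) := by
    have step : ∑ ℓ ∈ Finset.Ioc p q, diagWeight A ℓ =
        ∑ ℓ ∈ Finset.Ioc p q, (2 * A * (1 / (ℓ : ℝ)) - (ℓ : ℝ)) := by
      refine Finset.sum_congr rfl fun ℓ hℓ => ?_
      rw [Finset.mem_Ioc] at hℓ
      have hℓp : (p : ℝ) + 1 ≤ ℓ := by exact_mod_cast (show p + 1 ≤ ℓ by omega)
      have hℓq : (ℓ : ℝ) ≤ q := by exact_mod_cast hℓ.2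
      have hp0 : (0 : ℝ) ≤ p := Nat.cast_nonneg p
      have hℓ0 : (0 : ℝ) ≤ ℓ := Nat.cast_nonneg ℓ
      have hlt : A < ((ℓ : ℝ)) ^ 2 := lt_of_lt_of_le hAp (pow_le_pow_left₀ (by positivity) hℓp 2)
      have hle : ((ℓ : ℝ)) ^ 2 ≤ 2 * A := le_trans (pow_le_pow_left₀ hℓ0 hℓq 2) hqA
      rw [diagWeight_of_lt_sq_of_sq_le hlt hle, mul_one_div]
    rw [step, Finset.sum_sub_distrib, ← Finset.mul_sum, sum_Ioc_eq_sub _ hpq, sum_Ioc_eq_sub _ hpq,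
      sum_Icc_one_cast, sum_Icc_one_cast, harmonicR, harmonicR]
  -- range 3: `q < ℓ`
  have e3 : ∑ ℓ ∈ Finset.Ioc q L, diagWeight A ℓ = 0 := by
    refine Finset.sum_eq_zero fun ℓ hℓ => ?_
    rw [Finset.mem_Ioc] at hℓ
    have hℓq : (q : ℝ) + 1 ≤ ℓ := by exact_mod_cast (show q + 1 ≤ ℓ by omega)
    have hq0 : (0 : ℝ) ≤ q := Nat.cast_nonneg q
    exact diagWeight_of_two_mul_lt_sq hA0
      (lt_of_lt_of_le hAq (pow_le_pow_left₀ (by positivity) hℓq 2))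
  rw [e1, e2, e3]
  ring

/-! ### The estimate for `A ≥ 1`: the four error pieces -/

/-- Harmonic piece: `|c·H_n − c log n − cγ − c/(2n)| ≤ c/(8n²)` for `c ≥ 0`, `n ≥ 1`. [folklore] -/
theorem abs_mul_harmonicR_sub_le {n : ℕ} (hn : 1 ≤ n) {c : ℝ} (hc : 0 ≤ c) :
    |c * harmonicR n - c * Real.log n - c * Real.eulerMascheroniConstant - c / (2 * n)| ≤
      c / (8 * (n : ℝ) ^ 2) := by
  have h_le := harmonicR_le hn
  have h_ge := le_harmonicR hn
  have m1 := mul_le_mul_of_nonneg_left h_le hc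
  have m2 := mul_le_mul_of_nonneg_left h_ge hc
  have e : c * harmonicR n - c * Real.log n - c * Real.eulerMascheroniConstant - c / (2 * n) =
      c * (harmonicR n - Real.log n - Real.eulerMascheroniConstant - 1 / (2 * n)) := by ring
  have e1 : c * (Real.log n + Real.eulerMascheroniConstant + 1 / (2 * n)) =
      c * Real.log n + c * Real.eulerMascheroniConstant + c * (1 / (2 * n)) := by ring
  have e2 : c * (Real.log n + Real.eulerMascheroniConstant + 1 / (2 * n) - 1 / (8 * (n : ℝ) ^ 2)) =
      c * Real.log n + c * Real.eulerMascheroniConstant + c * (1 / (2 * n)) - c / (8 * (n : ℝ) ^ 2) := by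
    ring
  rw [e1] at m1
  rw [e2] at m2
  have hc8 : 0 ≤ c / (8 * (n : ℝ) ^ 2) := by positivity
  rw [e, abs_le]
  constructor <;> nlinarith

/-- Logarithmic piece: for `B > 0`, `q ≥ 1` and `q² ≤ B < (q+1)²`,
`|(B/2) log(q²/B) + (B − q²)/2| ≤ 9/2` (Taylor: `(B/2)|log(1−u) + u| ≤ (B/2)u²/(1−u) = (B−q²)²/(2q²)`
with `u = (B − q²)/B`, and `B − q² < 2q + 1 ≤ 3q`). [folklore] -/
theorem abs_log_piece_le {B q : ℝ} (hB : 0 < B) (hq : 1 ≤ q) (hqB : q ^ 2 ≤ B)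
    (hBq : B < (q + 1) ^ 2) : |B / 2 * Real.log (q ^ 2 / B) + (B - q ^ 2) / 2| ≤ 9 / 2 := by
  have hBne : B ≠ 0 := hB.ne'
  have hq0 : 0 < q := by linarith
  have hb0 : 0 ≤ B - q ^ 2 := by linarith
  have hb1 : B - q ^ 2 ≤ 3 * q := by nlinarith
  set u : ℝ := (B - q ^ 2) / B with hu
  have hu0 : 0 ≤ u := by rw [hu]; positivity
  have h1u : 1 - u = q ^ 2 / B := by rw [hu]; field_simp; ring
  have h1u0 : 0 < 1 - u := by rw [h1u]; positivity
  have hu1 : u < 1 := by linarith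
  have hBu : B / 2 * u = (B - q ^ 2) / 2 := by rw [hu]; field_simp
  have key : B / 2 * Real.log (q ^ 2 / B) + (B - q ^ 2) / 2 = B / 2 * (Real.log (1 - u) + u) := by
    rw [h1u, mul_add, hBu]
  -- `|log(1 − u) + u| ≤ u²/(1 − u)`: Mathlib's Taylor estimate with one term (the same four lines
  -- as `Literature.NumberTheory.Sieve.abs_log_one_sub_add_le_sq_div`, not imported to keep the
  -- import graph of this file light)
  have h : |Real.log (1 - u) + u| ≤ u ^ 2 / (1 - u) := by
    have hu' : |u| < 1 := by rw [abs_of_nonneg hu0]; exact hu1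
    have h0 := Real.abs_log_sub_add_sum_range_le hu' 1
    simp only [Finset.sum_range_one, Nat.cast_zero, zero_add, pow_one, div_one] at h0
    rw [abs_of_nonneg hu0] at h0
    rwa [add_comm] at h0
  have e2 : B / 2 * (u ^ 2 / (1 - u)) = (B - q ^ 2) ^ 2 / (2 * q ^ 2) := by
    rw [h1u, hu]; field_simp
  have hsq : (B - q ^ 2) ^ 2 ≤ (3 * q) ^ 2 := pow_le_pow_left₀ hb0 hb1 2
  have hbd : (B - q ^ 2) ^ 2 / (2 * q ^ 2) ≤ 9 / 2 := by
    rw [div_le_div_iff₀ (by positivity) (by norm_num)]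
    nlinarith
  rw [key, abs_mul, abs_of_pos (by positivity : (0 : ℝ) < B / 2)]
  calc B / 2 * |Real.log (1 - u) + u| ≤ B / 2 * (u ^ 2 / (1 - u)) :=
        mul_le_mul_of_nonneg_left h (by positivity)
    _ ≤ 9 / 2 := by rw [e2]; exact hbd

/-- Boundary piece: `0 ≤ (B − q²)/(2q) ≤ 3/2` for `q ≥ 1`, `q² ≤ B < (q+1)²`. [folklore] -/
theorem boundary_piece_mem {B q : ℝ} (hq : 1 ≤ q) (hqB : q ^ 2 ≤ B) (hBq : B < (q + 1) ^ 2) :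
    0 ≤ (B - q ^ 2) / (2 * q) ∧ (B - q ^ 2) / (2 * q) ≤ 3 / 2 := by
  have hq0 : 0 < q := by linarith
  have hb0 : 0 ≤ B - q ^ 2 := by linarith
  have hb1 : B - q ^ 2 ≤ 3 * q := by nlinarith
  refine ⟨by positivity, ?_⟩
  rw [div_le_div_iff₀ (by positivity) (by norm_num)]
  nlinarith

/-- `c/(8n²) ≤ 1/2` when `c < (n+1)²`, `n ≥ 1` (as `(n+1)² ≤ 4n²`). [folklore] -/
theorem div_eight_sq_le_half {c n : ℝ} (hn : 1 ≤ n) (hc : c < (n + 1) ^ 2) :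
    c / (8 * n ^ 2) ≤ 1 / 2 := by
  rw [div_le_div_iff₀ (by positivity) (by norm_num)]
  nlinarith

/-! ### The estimate for `A ≥ 1` -/

/-- **The normalised diagonal sum for `A ≥ 1`**:
`|Σ_{ℓ ≤ L} g_A(ℓ) − A(½ log A + γ + log 2 − ½)| ≤ 13` when `(L+1)² > 2A`. [folklore] -/
theorem abs_diagSum_sub_diagMain_le_of_one_le {A : ℝ} (hA : 1 ≤ A) {L : ℕ}
    (hL : 2 * A < ((L : ℝ) + 1) ^ 2) : |diagSum A L - diagMain A| ≤ 13 := by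
  have hA0 : 0 < A := by linarith
  have hAne : A ≠ 0 := hA0.ne'
  -- the integer square roots `p = ⌊√A⌋`, `q = ⌊√(2A)⌋`
  obtain ⟨hpA, hAp⟩ := natSqrt_floor_spec hA0.le
  obtain ⟨hqA, hAq⟩ := natSqrt_floor_spec (show (0 : ℝ) ≤ 2 * A by linarith)
  set p : ℕ := Nat.sqrt ⌊A⌋₊ with hpdef
  set q : ℕ := Nat.sqrt ⌊2 * A⌋₊ with hqdef
  have hp1 : 1 ≤ p := by
    rw [hpdef, Nat.le_sqrt, one_mul]
    exact Nat.le_floor (by exact_mod_cast hA)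
  have hq1 : 1 ≤ q := by
    rw [hqdef, Nat.le_sqrt, one_mul]
    exact Nat.le_floor (by push_cast; linarith)
  have hp0 : (1 : ℝ) ≤ p := by exact_mod_cast hp1
  have hq0 : (1 : ℝ) ≤ q := by exact_mod_cast hq1
  have hpne : (p : ℝ) ≠ 0 := ne_of_gt (by linarith)
  have hqne : (q : ℝ) ≠ 0 := ne_of_gt (by linarith)
  have hqL : q ≤ L := by
    have h1 : ((q : ℝ)) ^ 2 < ((L : ℝ) + 1) ^ 2 := lt_of_le_of_lt hqA hL
    have h2 : (q : ℝ) < (L : ℝ) + 1 := lt_of_pow_lt_pow_left₀ 2 (by positivity) h1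
    have h3 : q < L + 1 := by exact_mod_cast h2
    omega
  -- exact evaluation
  have hsum := diagSum_eq hpA hAp hqA hAq hqL
  -- the logarithms: `2 log q = log 2 + log A + log(q²/(2A))`, `2 log p = log A + log(p²/A)`
  have hlogq : 2 * Real.log (q : ℝ) = Real.log 2 + Real.log A + Real.log ((q : ℝ) ^ 2 / (2 * A)) := by
    rw [Real.log_div (by positivity) (by positivity), Real.log_pow, Real.log_mul (by norm_num) hAne]
    push_cast
    ring
  have hlogp : 2 * Real.log (p : ℝ) = Real.log A + Real.log ((p : ℝ) ^ 2 / A) := by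
    rw [Real.log_div (by positivity) hAne, Real.log_pow]
    push_cast
    ring
  -- the six error pieces
  have hP1 := abs_mul_harmonicR_sub_le hq1 (show (0 : ℝ) ≤ 2 * A by linarith)
  have hP2 := abs_mul_harmonicR_sub_le hp1 hA0.le
  have hB1 : 2 * A / (8 * (q : ℝ) ^ 2) ≤ 1 / 2 := div_eight_sq_le_half hq0 hAq
  have hB2 : A / (8 * (p : ℝ) ^ 2) ≤ 1 / 2 := div_eight_sq_le_half hp0 hAp
  have hP3 : |2 * A / 2 * Real.log ((q : ℝ) ^ 2 / (2 * A)) + (2 * A - (q : ℝ) ^ 2) / 2| ≤ 9 / 2 :=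
    abs_log_piece_le (by linarith) hq0 hqA hAq
  have hP4 : |A / 2 * Real.log ((p : ℝ) ^ 2 / A) + (A - (p : ℝ) ^ 2) / 2| ≤ 9 / 2 :=
    abs_log_piece_le hA0 hp0 hpA hAp
  have hP5 := boundary_piece_mem hq0 hqA hAq
  have hP6 := boundary_piece_mem hp0 hpA hAp
  -- the exact identity behind the cancellation of all `√A`-size terms
  have r1 : (2 * A - (q : ℝ) ^ 2) / (2 * q) = A / q - q / 2 := by field_simp
  have r2 : (A - (p : ℝ) ^ 2) / (2 * p) = A / (2 * p) - p / 2 := by field_simp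
  have hE : diagSum A L - diagMain A =
      (2 * A * harmonicR q - 2 * A * Real.log q - 2 * A * Real.eulerMascheroniConstant
          - 2 * A / (2 * q))
      - (A * harmonicR p - A * Real.log p - A * Real.eulerMascheroniConstant - A / (2 * p))
      + (2 * A / 2 * Real.log ((q : ℝ) ^ 2 / (2 * A)) + (2 * A - (q : ℝ) ^ 2) / 2)
      - (A / 2 * Real.log ((p : ℝ) ^ 2 / A) + (A - (p : ℝ) ^ 2) / 2)
      + (A / q - q / 2) - (A / (2 * p) - p / 2) := by
    rw [hsum, diagMain]
    linear_combination A * hlogq - (A / 2) * hlogp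
  rw [hE, abs_le]
  rw [r1] at hP5
  rw [r2] at hP6
  obtain ⟨h1a, h1b⟩ := abs_le.1 hP1
  obtain ⟨h2a, h2b⟩ := abs_le.1 hP2
  obtain ⟨h3a, h3b⟩ := abs_le.1 hP3
  obtain ⟨h4a, h4b⟩ := abs_le.1 hP4
  obtain ⟨h5a, h5b⟩ := hP5
  obtain ⟨h6a, h6b⟩ := hP6
  constructor <;> linarith

/-! ### The estimate for `A ≤ 1` and the general statement -/

/-- For `0 ≤ A ≤ 1` the sum is between `0` and `1`. [folklore] -/
theorem diagSum_mem_of_le_one {A : ℝ} (hA0 : 0 ≤ A) (hA1 : A ≤ 1) (L : ℕ) :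
    0 ≤ diagSum A L ∧ diagSum A L ≤ 1 := by
  refine ⟨Finset.sum_nonneg fun ℓ _ => diagWeight_nonneg A ℓ, ?_⟩
  calc diagSum A L ≤ ∑ ℓ ∈ Finset.Icc 1 L, (if ℓ = 1 then (1 : ℝ) else 0) :=
        Finset.sum_le_sum fun ℓ hℓ => diagWeight_le_of_le_one hA0 hA1 (Finset.mem_Icc.1 hℓ).1
    _ ≤ 1 := by
        rw [Finset.sum_ite_eq']
        split_ifs <;> norm_num

/-- `|A(½ log A + γ + log 2 − ½)| ≤ 2` for `0 < A ≤ 1`. [folklore] -/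
theorem abs_diagMain_le_of_le_one {A : ℝ} (hA0 : 0 < A) (hA1 : A ≤ 1) : |diagMain A| ≤ 2 := by
  have h1 : |Real.log A * A| < 1 := Real.abs_log_mul_self_lt A hA0 hA1
  have hγ1 := Real.eulerMascheroniConstant_lt_two_thirds
  have hγ0 := Real.one_half_lt_eulerMascheroniConstant
  have hl2 : Real.log 2 < 1 := by
    have := Real.log_two_lt_d9; linarith
  have hl2' : 0 < Real.log 2 := Real.log_pos one_lt_two
  have hc0 : 0 < Real.eulerMascheroniConstant + Real.log 2 - 1 / 2 := by linarith
  have m0 : 0 ≤ A * (Real.eulerMascheroniConstant + Real.log 2 - 1 / 2) := mul_nonneg hA0.le hc0.le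
  have m1 : A * (Real.eulerMascheroniConstant + Real.log 2 - 1 / 2) ≤
      1 * (Real.eulerMascheroniConstant + Real.log 2 - 1 / 2) := mul_le_mul_of_nonneg_right hA1 hc0.le
  have e : diagMain A =
      (Real.log A * A) / 2 + A * (Real.eulerMascheroniConstant + Real.log 2 - 1 / 2) := by
    rw [diagMain]; ring
  rw [e]
  obtain ⟨h1a, h1b⟩ := abs_lt.1 h1
  rw [abs_le]
  constructor <;> linarith

/-- **The normalised diagonal sum.** For every `A > 0` and every `L` with `(L+1)² > 2A`,
`|Σ_{1 ≤ ℓ ≤ L} (2A − max(A, ℓ²))⁺/ℓ − A(½ log A + γ + log 2 − ½)| ≤ 13`.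
[cite: Titchmarsh1986, §7.4] -/
theorem abs_diagSum_sub_diagMain_le {A : ℝ} (hA : 0 < A) {L : ℕ} (hL : 2 * A < ((L : ℝ) + 1) ^ 2) :
    |diagSum A L - diagMain A| ≤ 13 := by
  rcases le_or_gt 1 A with hA1 | hA1
  · exact abs_diagSum_sub_diagMain_le_of_one_le hA1 hL
  · obtain ⟨h0, h1⟩ := diagSum_mem_of_le_one hA.le hA1.le L
    obtain ⟨h2, h3⟩ := abs_le.1 (abs_diagMain_le_of_le_one hA hA1.le)
    rw [abs_le]
    constructor <;> linarith

/-! ### The scaled diagonal sum `D_L(M, T) = Σ_{ℓ ≤ L} ℓ⁻¹ (2T − max(T, 2πℓ²M²))⁺` -/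

/-- The diagonal sum of the BCH mean square on `[T, 2T]`:
`D_L(M,T) = Σ_{1 ≤ ℓ ≤ L} (2T − max(T, 2πℓ²M²))⁺ / ℓ` (`= Σ_ℓ ℓ⁻¹ |{t ∈ [T,2T] : 2πℓ²M² ≤ t}|`).
[cite: Titchmarsh1986, §7.4] -/
def bchDiagSum (M T : ℝ) (L : ℕ) : ℝ :=
  ∑ ℓ ∈ Finset.Icc 1 L, max (2 * T - max T (2 * π * (ℓ : ℝ) ^ 2 * M ^ 2)) 0 / ℓ

/-- Unfolding `bchDiagSum`. [folklore] -/
theorem bchDiagSum_def (M T : ℝ) (L : ℕ) : bchDiagSum M T L =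
    ∑ ℓ ∈ Finset.Icc 1 L, max (2 * T - max T (2 * π * (ℓ : ℝ) ^ 2 * M ^ 2)) 0 / ℓ := rfl

/-- Scaling of the positive part: `(2κA − max(κA, κx))⁺ = κ (2A − max(A, x))⁺` for `κ ≥ 0`.
[folklore] -/
theorem max_sub_max_scale (κ A x : ℝ) (hκ : 0 ≤ κ) :
    max (2 * (κ * A) - max (κ * A) (κ * x)) 0 = κ * max (2 * A - max A x) 0 := by
  rw [← mul_max_of_nonneg _ _ hκ, show 2 * (κ * A) - κ * max A x = κ * (2 * A - max A x) by ring,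
    mul_max_of_nonneg _ _ hκ, mul_zero]

/-- Scaling: `D_L(M, T) = 2πM² · G_L(T/(2πM²))`. [folklore] -/
theorem bchDiagSum_eq_mul_diagSum {M T : ℝ} (hM : 0 < M) (L : ℕ) :
    bchDiagSum M T L = 2 * π * M ^ 2 * diagSum (T / (2 * π * M ^ 2)) L := by
  have hκ : 0 < 2 * π * M ^ 2 := by positivity
  rw [bchDiagSum, diagSum, Finset.mul_sum]
  refine Finset.sum_congr rfl fun ℓ _ => ?_
  rw [diagWeight]
  have hT : T = 2 * π * M ^ 2 * (T / (2 * π * M ^ 2)) := by field_simp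
  have h2 : 2 * π * (ℓ : ℝ) ^ 2 * M ^ 2 = 2 * π * M ^ 2 * (ℓ : ℝ) ^ 2 := by ring
  have key := max_sub_max_scale (2 * π * M ^ 2) (T / (2 * π * M ^ 2)) ((ℓ : ℝ) ^ 2) hκ.le
  rw [← hT, ← h2] at key
  rw [key]
  ring

/-- **The diagonal sum of the BCH mean square.** For `M, T > 0` and `πM²(L+1)² > T`,
`|Σ_{1 ≤ ℓ ≤ L} ℓ⁻¹(2T − max(T, 2πℓ²M²))⁺ − T(½ log(T/(2πM²)) + γ + log 2 − ½)| ≤ 26π M²`.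
With `M = M_{hk} = max(h,k)/(h,k)` and the weights `a_h ā_k/[h,k]`, twice this is the diagonal
`T Σ a_h ā_k/[h,k](log(T/(2πM_{hk}²)) + 2γ + log 4 − 1) + O(N^{2+ε})` of `2∫_T^{2T}|zA|²`.
[cite: BettinChandeeRadziwill2017, (1.2)] -/
theorem abs_bchDiagSum_sub_le {M T : ℝ} (hM : 0 < M) (hT : 0 < T) {L : ℕ}
    (hL : T < π * M ^ 2 * ((L : ℝ) + 1) ^ 2) :
    |bchDiagSum M T L - T * (Real.log (T / (2 * π * M ^ 2)) / 2 + Real.eulerMascheroniConstant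
        + Real.log 2 - 1 / 2)| ≤ 26 * π * M ^ 2 := by
  have hκ : 0 < 2 * π * M ^ 2 := by positivity
  have hA : 0 < T / (2 * π * M ^ 2) := by positivity
  have hLA : 2 * (T / (2 * π * M ^ 2)) < ((L : ℝ) + 1) ^ 2 := by
    have e : 2 * (T / (2 * π * M ^ 2)) = T / (π * M ^ 2) := by
      field_simp
    rw [e, div_lt_iff₀ (by positivity)]
    calc T < π * M ^ 2 * ((L : ℝ) + 1) ^ 2 := hL
      _ = ((L : ℝ) + 1) ^ 2 * (π * M ^ 2) := by ring
  have h := abs_diagSum_sub_diagMain_le hA hLA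
  have e2 : T * (Real.log (T / (2 * π * M ^ 2)) / 2 + Real.eulerMascheroniConstant
      + Real.log 2 - 1 / 2) = 2 * π * M ^ 2 * diagMain (T / (2 * π * M ^ 2)) := by
    rw [diagMain]
    field_simp
  rw [bchDiagSum_eq_mul_diagSum hM, e2, ← mul_sub, abs_mul, abs_of_pos hκ]
  calc 2 * π * M ^ 2 * |diagSum (T / (2 * π * M ^ 2)) L - diagMain (T / (2 * π * M ^ 2))|
      ≤ 2 * π * M ^ 2 * 13 := mul_le_mul_of_nonneg_left h hκ.le
    _ = 26 * π * M ^ 2 := by ring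

/-! ### The bridge to the activated mean value theorem: `∫_T^{T'} [c ≤ t] dt = (T' − max(T,c))⁺` -/

/-- `∫_T^{T'} [c ≤ t] dt = (T' − max(T, c))⁺` for `T ≤ T'`. [folklore] -/
theorem integral_indicator_le_eq_max {T T' : ℝ} (hTT' : T ≤ T') (c : ℝ) :
    ∫ t in T..T', (if c ≤ t then (1 : ℝ) else 0) = max (T' - max T c) 0 := by
  have hfun : (fun t : ℝ => if c ≤ t then (1 : ℝ) else 0) =
      (Set.Ici c).indicator fun _ => (1 : ℝ) := by
    funext t
    simp only [Set.indicator_apply, Set.mem_Ici]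
  rw [intervalIntegral.integral_of_le hTT', hfun, setIntegral_indicator measurableSet_Ici,
    setIntegral_const, smul_eq_mul, mul_one]
  rcases le_or_gt c T with hcT | hTc
  · -- `c ≤ T`: the whole interval counts
    have e : Set.Ioc T T' ∩ Set.Ici c = Set.Ioc T T' := by
      ext t
      simp only [Set.mem_inter_iff, Set.mem_Ioc, Set.mem_Ici]
      constructor
      · exact fun h => h.1
      · exact fun h => ⟨h, by linarith [h.1]⟩
    rw [e, Real.volume_real_Ioc_of_le hTT', max_eq_left hcT, max_eq_left (by linarith)]
  · -- `T < c`: the part `[c, T']` counts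
    have e : Set.Ioc T T' ∩ Set.Ici c = Set.Icc c T' := by
      ext t
      simp only [Set.mem_inter_iff, Set.mem_Ioc, Set.mem_Ici, Set.mem_Icc]
      constructor
      · exact fun h => ⟨h.2, h.1.2⟩
      · exact fun h => ⟨⟨by linarith [h.1], h.2⟩, h.1⟩
    rw [e, Real.volume_real_Icc, max_eq_right hTc.le]

/-- The same with two activation constraints and complex values, in the shape produced by
`Literature.NumberTheory.LFunctions.DirichletMVT.norm_weighted_meanSquare_activated_sub_le_crude`
with the weight `w = 1`: `∫_T^{T'} [τ ≤ t ∧ τ' ≤ t] dt = (T' − max(T, max(τ, τ')))⁺`. [folklore] -/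
theorem integral_indicator_le_eq_max_complex {T T' : ℝ} (hTT' : T ≤ T') (τ τ' : ℝ) :
    ∫ t in T..T', (if τ ≤ t ∧ τ' ≤ t then (((1 : ℝ)) : ℂ) else 0) =
      ((max (T' - max T (max τ τ')) 0 : ℝ) : ℂ) := by
  have hfun : (fun t : ℝ => if τ ≤ t ∧ τ' ≤ t then (((1 : ℝ)) : ℂ) else 0) =
      fun t : ℝ => (((if max τ τ' ≤ t then (1 : ℝ) else 0 : ℝ)) : ℂ) := by
    funext t
    by_cases h : max τ τ' ≤ t
    · rw [if_pos (max_le_iff.1 h), if_pos h]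
    · rw [if_neg (fun h' => h (max_le_iff.2 h')), if_neg h, Complex.ofReal_zero]
  rw [hfun, intervalIntegral.integral_ofReal, integral_indicator_le_eq_max hTT']

/-- In particular, on `[T, 2T]` with the activation times `2πn²`, `2πn'²` of a coincidence
`n = ℓk'`, `n' = ℓh'` (so that `max(2πn², 2πn'²) = 2πℓ²M²`, `M = max(h', k')`):
`∫_T^{2T} [2πℓ²M² ≤ t] dt = (2T − max(T, 2πℓ²M²))⁺`, the summand of `bchDiagSum`. [folklore] -/
theorem integral_indicator_activation_eq {T : ℝ} (hT : 0 ≤ T) (ℓ : ℕ) (M : ℝ) :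
    ∫ t in T..(2 * T), (if 2 * π * (ℓ : ℝ) ^ 2 * M ^ 2 ≤ t then (1 : ℝ) else 0) =
      max (2 * T - max T (2 * π * (ℓ : ℝ) ^ 2 * M ^ 2)) 0 :=
  integral_indicator_le_eq_max (by linarith) _

end Literature.NumberTheory.LFunctions.BCH
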